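import Summits.QuantumFields.BalabanUV.Beta.SecondOrderStepEvalComb
import Summits.QuantumFields.BalabanUV.Beta.SpineRecursiveT2StepSym
import Summits.QuantumFields.BalabanUV.Beta.SecondOrderStepLawGen
import Summits.QuantumFields.BalabanUV.Beta.ReflectionLocusSymPure
import Summits.QuantumFields.BalabanUV.Beta.LagrangeFoldComb
import Summits.QuantumFields.BalabanUV.Beta.RecursiveWSlot
import Summits.QuantumFields.BalabanUV.Beta.StepReflectionRecSlot
import Summits.QuantumFields.BalabanUV.Beta.MultiplierTableSlot

/-!
# `BalabanUV.Beta.SpineRecursiveT2StepComb` — binder row D1, RULING R-D1-g35-1 (chart (III′)), brick P6-2: **THE LEVEL STEP OF THE SECOND-ORDER LETTER LAW (hT2-rem)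
# FOR THE SLOTTED TABLES AT THE COMB-CHART RESOLVENTS `GcombSh Lc`** — the (III′) twin of `SpineRecursiveT2StepSym` (gen 31, (N7c-i)): the same wiring over
# `SecondOrderStepEvalComb.mmRead_K3OfK_GcombSh_bref_of_law'` (P6-1) and the comb-chart (c1)′ fold `LagrangeFoldComb.dM_SpureRecOf_M1Of_eq_vertexOfK_SrecOf_comb`,
# at an1's shift `Dsh Lc` (the shift letters (Dspr)(Dnull)(Dff)(Dmm)(DG) are THEOREMS here — `DshAn1`, P2, `CombChartShiftNull` — and no longer displayed)

HONEST FRAMING (cell charter, verbatim): «discharging BetaPertH makes Bałaban's UV stability UNCONDITIONAL — a real constructive-QFT result; it is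
NOT the continuum limit and NOT the Clay problem.»  HONEST DEPENDENCY: continuum YM on T⁴ ⇐ BetaPertH ∧ nine spine estimates (0/9 proved); BetaPertH
⇐ (D1) ∧ (D4) ∧ CAP+tail; G-an2-4 gates asym, D1 and NE2/3/4.  DERIVED cell leaf (wiring, [folklore]; β sub-cell, BINDER-OWNERS row D1 OWNER `b2b-balaban-beta-an2`
gen 36, programme P6 = the (III′) twins of the chart-(II) second-order hR engine chain); no statement of Bałaban's papers, no `[cite:]`, no `def`, no `Prop` fact; EVERY
table LETTER IS A HYPOTHESIS; instantiates no binder of the wall.  RECORD = ROOT M′ p303989 (chart (II)) unchanged.  NOT D1, NOT `BetaPertH`, NOT continuum, NOT Clay.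
WHAT: `SpureRecOf_succ_eq_mmRead_comb` (the next pure table in `mmRead ∘ K2OfK` form at `G′`), **`T2RecOf_succ_bref_of_laws_comb`** (statement = `T2RecOf_succ_bref_of_laws_sym`
with `Gsym ↦ GcombSh`, `Dsh ↦ Dsh Lc`, shift hypotheses dropped).  `T2RecOf_succ_eq_mmRead` (resolvent-generic) is chart (II)'s, reused BY NAME.
Provenance: β sub-cell, unit beta-an2 gen 36, 2026-08-22 (v1); text of `SpineRecursiveT2StepSym` transformed by name; no existing file touched.
-/

open Finset
open scoped BigOperators
open Literature.Probability.LatticeModels (Torus.proj)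
open Literature.MathematicalPhysics.QuantumFieldTheory
open Literature.MathematicalPhysics.QuantumFieldTheory.Balaban1983to89
open Literature.MathematicalPhysics.QuantumFieldTheory.Balaban1983to89.Beta
open ExpKernelCalculus (MKer Decays BiLoc comp VertexFamily VertexFamily₂)
open PolarizationSign (reflSign)
open KernelReflection (refK)
open ResolventReflection (bref Φ)
open OneStepResolventKernel (Fib LocStencil)
open OneStepKernelFamily (KInvStep colH vertexOfK vertexFamily_vertexOfK')
open BalabanStepJetsSucc (mmRead wE wVH)
open BalabanStepW2 (K3OfK wV4 wB2)
open BalabanCompositeJets (LocStencil₂)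
open SecondOrderResponse (dM K2OfK LocStencilFM)
open Summit.QuantumFields.BalabanUV.Beta.TameKernelCalculus
open Summit.QuantumFields.BalabanUV.Beta.ChartConjugation (conjV conjW)
open Summit.QuantumFields.BalabanUV.Beta.AxialDressingRooted (one_le_of_neZero)
open Summit.QuantumFields.BalabanUV.Beta.BorderedHessian (bhK diagK stepScale stepScale_ne_zero)
open Summit.QuantumFields.BalabanUV.Beta.SymSliceProjectorKernel (symEc)
open Summit.QuantumFields.BalabanUV.Beta.WardLocusCubic (mmSym)
open Summit.QuantumFields.BalabanUV.Beta.WardLocusRecursive (SrecOf)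
open Summit.QuantumFields.BalabanUV.Beta.ChartConjugationDefectEnd (sandwichDefect)
open Summit.QuantumFields.BalabanUV.Beta.CombChartStepJets (GcombSh decays_GcombSh)
open Summit.QuantumFields.BalabanUV.Beta.SymShiftedSpread (bhKStepSh)
open Summit.QuantumFields.BalabanUV.Beta.DshAn1 (Dsh)
open Summit.QuantumFields.BalabanUV.Beta.E3ContactGenerator (ctGenM)
open Summit.QuantumFields.BalabanUV.Beta.SecondOrderContactMmRead (mmRead_K2OfK_eq_e3OfK)
open Summit.QuantumFields.BalabanUV.Beta.SecondOrderStepEvalComb (mmRead_K3OfK_GcombSh_bref_of_law')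
open Summit.QuantumFields.BalabanUV.Beta.SecondOrderStepLawGen (quarticStep_bref_of_laws_gen)
open Summit.QuantumFields.BalabanUV.Beta.ReflectionLocusSymPure (M1Of_bref)
open Summit.QuantumFields.BalabanUV.Beta.CombChartContactFactor (mmRead_GcombSh_inl_inl_eq)
open Summit.QuantumFields.BalabanUV.Beta.LagrangeFoldComb (dM_SpureRecOf_M1Of_eq_vertexOfK_SrecOf_comb)
open Summit.QuantumFields.BalabanUV.Beta.StepReflectionRecSlot (smul_slot_inl_inl)
open Summit.QuantumFields.BalabanUV.Beta.LagrangeFoldStep (wVH_ne_zero)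

noncomputable section

namespace Summit.QuantumFields.BalabanUV.Beta.SpineRooted

section CombStep

variable {d Lc : ℕ} [NeZero Lc]

/-- [folklore] **THE NEXT PURE SLOT TABLE IN `mmRead ∘ K2OfK` FORM AT THE SYMMETRISED RESOLVENTS**:
`Sp_{j+1} κ u = (cE·wE (j+1)) • mmRead Lc (K2OfK G_j Lc Sp_j M_j κ u) + (cVH·wVH (j+1)) • V κ u`
(`SpureRecOf_succ`; `e3OfK Lc G_j (SrecOf j) = mmRead Lc (K2OfK …)` by `mmRead_K2OfK_eq_e3OfK` + K2's (c1) fold `dM_SpureRecOf_M1Of_eq_vertexOfK_SrecOf_comb`). -/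
theorem SpureRecOf_succ_eq_mmRead_comb {V H : Fin (d + 1) → (Fin (d + 1) → ℤ) → MKer (d + 1) (Fib d)}
    (hV : ∀ δ : ℝ, 0 ≤ δ → ∃ C : ℝ, LocStencil V C δ) (hH : ∀ δ : ℝ, 0 ≤ δ → ∃ C : ℝ, VertexFamily H Lc C δ) (cE cVH cΛ : ℝ) (j : ℕ)
    (κ : Fin (d + 1)) (u : Fin (d + 1) → ℤ) :
    SpureRecOf d Lc V H (GcombSh Lc) cE cVH cΛ (j + 1) κ u =
      (cE * wE d Lc (j + 1)) • mmRead Lc (K2OfK (GcombSh (d := d) Lc j) Lc (SpureRecOf d Lc V H (GcombSh Lc) cE cVH cΛ j) (M1Of d Lc H cΛ j) κ u) +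
        (cVH * wVH d Lc (j + 1)) • V κ u := by
  simp only [SpureRecOf_succ]
  rw [mmRead_K2OfK_eq_e3OfK _ κ u (dM_SpureRecOf_M1Of_eq_vertexOfK_SrecOf_comb hV hH cE cVH cΛ j κ u)]

/-- [folklore] **THE LEVEL STEP OF THE SECOND-ORDER LETTER LAW FOR THE SLOTTED RECURSIVE TABLES AT THE SYMMETRISED RESOLVENTS** (see the module
docstring): (hT2-rem) at level `j+1` with second symbol `hB` and the displayed remainder (carrying the four inner sandwich-defect words), from the W-law at
level `j`, the border letter at level `j+1` against the shifted spread, the two units locks, and the table letters (V-ff0), (H-r). -/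
theorem T2RecOf_succ_bref_of_laws_comb (hLc : Odd Lc)
    {V H : Fin (d + 1) → (Fin (d + 1) → ℤ) → MKer (d + 1) (Fib d)}
    (hV : ∀ δ : ℝ, 0 ≤ δ → ∃ C : ℝ, LocStencil V C δ) (hH : ∀ δ : ℝ, 0 ≤ δ → ∃ C : ℝ, VertexFamily H Lc C δ)
    (hV0 : ∀ (κ : Fin (d + 1)) (w x z : Fin (d + 1) → ℤ) (β β' : Fin (d + 1)), V κ w x z (Sum.inl β) (Sum.inl β') = 0)
    (hHr : ∀ (α μ : Fin (d + 1)) (y : Fin (d + 1) → ℤ), H μ (bref α μ y) = reflSign α μ • refK (Φ (d := d) Lc α) (H μ y))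
    (cE cVH cΛ cE₂ cB : ℝ) (T : Fin 4 → Fin 4 → Fin 4 → Fin 4 → ℝ)
    {vh₂S : Fin (d + 1) → (Fin (d + 1) → ℤ) → Fin (d + 1) → (Fin (d + 1) → ℤ) → MKer (d + 1) (Fib d)} (hB2 : ∃ C δ : ℝ, 0 < δ ∧ LocStencil₂ vh₂S C δ)
    (hB0 : ∀ κ u κ' u' (x z : Fin (d + 1) → ℤ) (β β' : Fin (d + 1)), vh₂S κ u κ' u' x z (Sum.inl β) (Sum.inl β') = 0)
    {mixFF : Fin (d + 1) → (Fin (d + 1) → ℤ) → Fin (d + 1) → (Fin (d + 1) → ℤ) → MKer (d + 1) (Fib d)} (hmix : ∃ C δ : ℝ, 0 < δ ∧ LocStencilFM Lc mixFF C δ)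
    (γ : ℕ → ℝ)
    (hlock : ∀ j, cE * wE d Lc (j + 1) * (γ j / (stepScale d Lc j * (Lc : ℝ) ^ (d + 1))) / wVH d Lc (j + 1) = γ (j + 1))
    (hlock2 : ∀ j, cE₂ * wV4 d Lc (j + 1) * wVH d Lc (j + 1) = (cE * wE d Lc (j + 1)) ^ 2)
    (j : ℕ) (α : Fin (d + 1))
    -- the level-`j` sharp law of the pure slot tables (the induction hypothesis; `SpureSymOf_bref_all` at the literal's pins)
    (hSp : ∀ κ u, SpureRecOf d Lc V H (GcombSh Lc) cE cVH cΛ j κ (bref α κ u) = reflSign α κ • refK (Φ Lc α)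
      (SpureRecOf d Lc V H (GcombSh Lc) cE cVH cΛ j κ u + conjV (bhKStepSh d Lc (Dsh Lc) j) (diagK fun p c => γ j * ctGenM d (bhK Lc + Dsh Lc) α Lc κ u p c)))
    -- the level-`j` W-law with ♯-bi-table of similarity shape up to `Rm`
    (X2s : Fin (d + 1) → (Fin (d + 1) → ℤ) → Fin (d + 1) → (Fin (d + 1) → ℤ) → (Fin (d + 1) → ℤ) → Fib d → ℝ)
    (Rm : Fin (d + 1) → (Fin (d + 1) → ℤ) → Fin (d + 1) → (Fin (d + 1) → ℤ) → MKer (d + 1) (Fib d))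
    (hX2L : ∀ μ y ν y', Loc (diagK (X2s μ y ν y'))) (hRmL : ∀ μ y ν y', Loc (Rm μ y ν y'))
    (hWlaw : ∀ μ y ν y',
      WrecOf d Lc (GcombSh Lc) (SpureRecOf d Lc V H (GcombSh Lc) cE cVH cΛ) (M1Of d Lc H cΛ) cE₂ cB T vh₂S mixFF j μ (bref α μ y) ν (bref α ν y') =
        (reflSign α μ * reflSign α ν) • refK (Φ Lc α)
          (WrecOf d Lc (GcombSh Lc) (SpureRecOf d Lc V H (GcombSh Lc) cE cVH cΛ) (M1Of d Lc H cΛ) cE₂ cB T vh₂S mixFF j μ y ν y' +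
            conjW (bhKStepSh d Lc (Dsh Lc) j)
              (dM (GcombSh Lc j) Lc (SpureRecOf d Lc V H (GcombSh Lc) cE cVH cΛ j) (M1Of d Lc H cΛ j) μ y)
              (dM (GcombSh Lc j) Lc (SpureRecOf d Lc V H (GcombSh Lc) cE cVH cΛ j) (M1Of d Lc H cΛ j) ν y')
              (diagK fun p c => ∑ κ, ∑' u, colH (GcombSh Lc j) Lc μ y κ u * (γ j * ctGenM d (bhK Lc + Dsh Lc) α Lc κ u p c))
              (diagK fun p c => ∑ κ, ∑' u, colH (GcombSh Lc j) Lc ν y' κ u * (γ j * ctGenM d (bhK Lc + Dsh Lc) α Lc κ u p c))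
              (diagK (X2s μ y ν y')) + Rm μ y ν y'))
    -- the border letter at level `j+1` against the next shifted spread, symbol `hB`, remainder `RB` (zero field block)
    (hB : Fin (d + 1) → (Fin (d + 1) → ℤ) → Fin (d + 1) → (Fin (d + 1) → ℤ) → (Fin (d + 1) → ℤ) → Fib d → ℝ)
    (RB : Fin (d + 1) → (Fin (d + 1) → ℤ) → Fin (d + 1) → (Fin (d + 1) → ℤ) → MKer (d + 1) (Fib d))
    (hRBff : ∀ κ u κ' u' (x z : Fin (d + 1) → ℤ) (β β' : Fin (d + 1)), RB κ u κ' u' x z (Sum.inl β) (Sum.inl β') = 0)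
    (hBfm : ∀ κ u κ' u' (x z : Fin (d + 1) → ℤ) (β m : Fin (d + 1)),
      ((cB * wB2 d Lc (j + 1)) • vh₂S κ (bref α κ u) κ' (bref α κ' u')) x z (Sum.inl β) (Sum.inr m) =
        ((reflSign α κ * reflSign α κ') • refK (Φ Lc α) ((cB * wB2 d Lc (j + 1)) • vh₂S κ u κ' u' +
          conjW (bhKStepSh d Lc (Dsh Lc) (j + 1))
            (SpureRecOf d Lc V H (GcombSh Lc) cE cVH cΛ (j + 1) κ u) (SpureRecOf d Lc V H (GcombSh Lc) cE cVH cΛ (j + 1) κ' u')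
            (diagK fun p c => γ (j + 1) * ctGenM d (bhK Lc + Dsh Lc) α Lc κ u p c) (diagK fun p c => γ (j + 1) * ctGenM d (bhK Lc + Dsh Lc) α Lc κ' u' p c)
            (diagK (hB κ u κ' u')) + RB κ u κ' u')) x z (Sum.inl β) (Sum.inr m))
    (hBmf : ∀ κ u κ' u' (x z : Fin (d + 1) → ℤ) (m β : Fin (d + 1)),
      ((cB * wB2 d Lc (j + 1)) • vh₂S κ (bref α κ u) κ' (bref α κ' u')) x z (Sum.inr m) (Sum.inl β) =
        ((reflSign α κ * reflSign α κ') • refK (Φ Lc α) ((cB * wB2 d Lc (j + 1)) • vh₂S κ u κ' u' +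
          conjW (bhKStepSh d Lc (Dsh Lc) (j + 1))
            (SpureRecOf d Lc V H (GcombSh Lc) cE cVH cΛ (j + 1) κ u) (SpureRecOf d Lc V H (GcombSh Lc) cE cVH cΛ (j + 1) κ' u')
            (diagK fun p c => γ (j + 1) * ctGenM d (bhK Lc + Dsh Lc) α Lc κ u p c) (diagK fun p c => γ (j + 1) * ctGenM d (bhK Lc + Dsh Lc) α Lc κ' u' p c)
            (diagK (hB κ u κ' u')) + RB κ u κ' u')) x z (Sum.inr m) (Sum.inl β))
    (hBmm : ∀ κ u κ' u' (x z : Fin (d + 1) → ℤ) (m m' : Fin (d + 1)),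
      ((cB * wB2 d Lc (j + 1)) • vh₂S κ (bref α κ u) κ' (bref α κ' u')) x z (Sum.inr m) (Sum.inr m') =
        ((reflSign α κ * reflSign α κ') • refK (Φ Lc α) ((cB * wB2 d Lc (j + 1)) • vh₂S κ u κ' u' +
          conjW (bhKStepSh d Lc (Dsh Lc) (j + 1))
            (SpureRecOf d Lc V H (GcombSh Lc) cE cVH cΛ (j + 1) κ u) (SpureRecOf d Lc V H (GcombSh Lc) cE cVH cΛ (j + 1) κ' u')
            (diagK fun p c => γ (j + 1) * ctGenM d (bhK Lc + Dsh Lc) α Lc κ u p c) (diagK fun p c => γ (j + 1) * ctGenM d (bhK Lc + Dsh Lc) α Lc κ' u' p c)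
            (diagK (hB κ u κ' u')) + RB κ u κ' u')) x z (Sum.inr m) (Sum.inr m'))
    (κ : Fin (d + 1)) (u : Fin (d + 1) → ℤ) (κ' : Fin (d + 1)) (u' : Fin (d + 1) → ℤ) :
    T2RecOf d Lc (GcombSh Lc) (SpureRecOf d Lc V H (GcombSh Lc) cE cVH cΛ) (M1Of d Lc H cΛ) cE₂ cB T vh₂S mixFF (j + 1) κ (bref α κ u) κ' (bref α κ' u') =
      (reflSign α κ * reflSign α κ') • refK (Φ Lc α)
        (T2RecOf d Lc (GcombSh Lc) (SpureRecOf d Lc V H (GcombSh Lc) cE cVH cΛ) (M1Of d Lc H cΛ) cE₂ cB T vh₂S mixFF (j + 1) κ u κ' u' +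
          conjW (bhKStepSh d Lc (Dsh Lc) (j + 1))
            (SpureRecOf d Lc V H (GcombSh Lc) cE cVH cΛ (j + 1) κ u) (SpureRecOf d Lc V H (GcombSh Lc) cE cVH cΛ (j + 1) κ' u')
            (diagK fun p c => γ (j + 1) * ctGenM d (bhK Lc + Dsh Lc) α Lc κ u p c) (diagK fun p c => γ (j + 1) * ctGenM d (bhK Lc + Dsh Lc) α Lc κ' u' p c)
            (diagK (hB κ u κ' u')) +
          (-((cE₂ * wV4 d Lc (j + 1)) • mmRead Lc
              (comp (comp (GcombSh Lc j) (Rm κ u κ' u')) (GcombSh Lc j) -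
                (comp (sandwichDefect (GcombSh Lc j) (bhKStepSh d Lc (Dsh Lc) j)
                      (diagK fun p c => ∑ ι, ∑' v, colH (GcombSh Lc j) Lc κ u ι v * (γ j * ctGenM d (bhK Lc + Dsh Lc) α Lc ι v p c)))
                    (comp (dM (GcombSh Lc j) Lc (SpureRecOf d Lc V H (GcombSh Lc) cE cVH cΛ j) (M1Of d Lc H cΛ j) κ' u') (GcombSh Lc j) -
                      diagK fun p c => ∑ ι, ∑' v, colH (GcombSh Lc j) Lc κ' u' ι v * (γ j * ctGenM d (bhK Lc + Dsh Lc) α Lc ι v p c))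
                  + comp (comp (GcombSh Lc j) (dM (GcombSh Lc j) Lc (SpureRecOf d Lc V H (GcombSh Lc) cE cVH cΛ j) (M1Of d Lc H cΛ j) κ u +
                      conjV (bhKStepSh d Lc (Dsh Lc) j) (diagK fun p c => ∑ ι, ∑' v, colH (GcombSh Lc j) Lc κ u ι v * (γ j * ctGenM d (bhK Lc + Dsh Lc) α Lc ι v p c))))
                    (sandwichDefect (GcombSh Lc j) (bhKStepSh d Lc (Dsh Lc) j)
                      (diagK fun p c => ∑ ι, ∑' v, colH (GcombSh Lc j) Lc κ' u' ι v * (γ j * ctGenM d (bhK Lc + Dsh Lc) α Lc ι v p c)))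
                  + comp (sandwichDefect (GcombSh Lc j) (bhKStepSh d Lc (Dsh Lc) j)
                      (diagK fun p c => ∑ ι, ∑' v, colH (GcombSh Lc j) Lc κ' u' ι v * (γ j * ctGenM d (bhK Lc + Dsh Lc) α Lc ι v p c)))
                    (comp (dM (GcombSh Lc j) Lc (SpureRecOf d Lc V H (GcombSh Lc) cE cVH cΛ j) (M1Of d Lc H cΛ j) κ u) (GcombSh Lc j) -
                      diagK fun p c => ∑ ι, ∑' v, colH (GcombSh Lc j) Lc κ u ι v * (γ j * ctGenM d (bhK Lc + Dsh Lc) α Lc ι v p c))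
                  + comp (comp (GcombSh Lc j) (dM (GcombSh Lc j) Lc (SpureRecOf d Lc V H (GcombSh Lc) cE cVH cΛ j) (M1Of d Lc H cΛ j) κ' u' +
                      conjV (bhKStepSh d Lc (Dsh Lc) j) (diagK fun p c => ∑ ι, ∑' v, colH (GcombSh Lc j) Lc κ' u' ι v * (γ j * ctGenM d (bhK Lc + Dsh Lc) α Lc ι v p c))))
                    (sandwichDefect (GcombSh Lc j) (bhKStepSh d Lc (Dsh Lc) j)
                      (diagK fun p c => ∑ ι, ∑' v, colH (GcombSh Lc j) Lc κ u ι v * (γ j * ctGenM d (bhK Lc + Dsh Lc) α Lc ι v p c)))))) +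
            RB κ u κ' u' +
            conjV (mmRead Lc (GcombSh (d := d) Lc j))
              (diagK fun p c => cE₂ * wV4 d Lc (j + 1) * mmSym Lc (X2s κ u κ' u') p c - wVH d Lc (j + 1) * hB κ u κ' u' p c))) := by
  have hL1 : 1 ≤ Lc := one_le_of_neZero Lc
  have hG : ∀ j : ℕ, ∃ δ C : ℝ, 0 < δ ∧ 0 ≤ C ∧ Decays (GcombSh (d := d) Lc j) C δ := decays_GcombSh Lc
  -- the multiplier tables reflect by a pure sign (H-r)
  have hMr : ∀ (ρ : Fin (d + 1)) (w : Fin (d + 1) → ℤ),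
      M1Of d Lc H cΛ j ρ (bref α ρ w) = reflSign α ρ • refK (Φ Lc α) (M1Of d Lc H cΛ j ρ w) := fun ρ w => M1Of_bref hHr cΛ j α ρ w
  -- localisations of the level-`j` letters
  have hSloc : ∀ j : ℕ, ∃ Cs δ : ℝ, 0 < δ ∧ LocStencil (SpureRecOf d Lc V H (GcombSh Lc) cE cVH cΛ j) Cs δ :=
    locStencil_SpureRecOf hL1 hV hH hG cE cVH cΛ
  have hMloc : ∀ j : ℕ, ∃ CM δ : ℝ, 0 < δ ∧ VertexFamily (M1Of d Lc H cΛ j) Lc CM δ := fun j => by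
    obtain ⟨C, hC⟩ := hH 1 zero_le_one
    exact ⟨_, 1, one_pos, vertexFamily_M1Of hC cΛ j⟩
  have hD : ∀ (ν : Fin (d + 1)) (y' : Fin (d + 1) → ℤ),
      Loc (dM (GcombSh (d := d) Lc j) Lc (SpureRecOf d Lc V H (GcombSh Lc) cE cVH cΛ j) (M1Of d Lc H cΛ j) ν y') := by
    intro ν y'
    rw [dM_SpureRecOf_M1Of_eq_vertexOfK_SrecOf_comb hV hH cE cVH cΛ j ν y']
    obtain ⟨Cs, δs, hδs, hS⟩ := locStencil_SrecOf hL1 hV hH hG cE cVH cΛ j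
    obtain ⟨Cv, δv, hδv, hVx⟩ := vertexFamily_vertexOfK' (N := Lc) (hG j) hS hδs
    exact ⟨_, _, Cv, δv, hδv, hVx ν y'⟩
  have hWl : ∀ (μ : Fin (d + 1)) (y : Fin (d + 1) → ℤ) (ν : Fin (d + 1)) (y' : Fin (d + 1) → ℤ),
      Loc (WrecOf d Lc (GcombSh Lc) (SpureRecOf d Lc V H (GcombSh Lc) cE cVH cΛ) (M1Of d Lc H cΛ) cE₂ cB T vh₂S mixFF j μ y ν y') := by
    intro μ y ν y'
    obtain ⟨Cw, δw, hδw, hW⟩ := vertexFamily₂_WrecOf' cE₂ cB T vh₂S mixFF hL1 hG hSloc hMloc hB2 hmix j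
    exact ⟨_, _, Cw, δw, hδw, hW μ y ν y'⟩
  -- the evaluated law of the field sector (transport + inverse shape WITH DEFECT + chart-free mm-read), remainder packaged
  have hQ := fun κ u κ' u' => mmRead_K3OfK_GcombSh_bref_of_law' hLc j (γ j) hSp hMr hWlaw (hSloc j) hD hWl hRmL hX2L
    κ u κ' u'
  -- the coefficients
  have hw : wVH d Lc (j + 1) ≠ 0 := LagrangeFoldStep.wVH_ne_zero (j + 1)
  have hγ' : γ (j + 1) = cE * wE d Lc (j + 1) * (γ j / (stepScale d Lc j * (Lc : ℝ) ^ (d + 1))) / wVH d Lc (j + 1) := (hlock j).symm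
  have ha : cE₂ * wV4 d Lc (j + 1) = (cE * wE d Lc (j + 1)) ^ 2 / wVH d Lc (j + 1) := by
    rw [eq_div_iff hw]; exact hlock2 j
  have hff : ∀ (x z : Fin (d + 1) → ℤ) (β β' : Fin (d + 1)), bhKStepSh d Lc (Dsh Lc) (j + 1) x z (Sum.inl β) (Sum.inl β') =
      wVH d Lc (j + 1) * mmRead Lc (GcombSh (d := d) Lc j) x z (Sum.inl β) (Sum.inl β') := fun x z β β' => by
    rw [mmRead_GcombSh_inl_inl_eq j, ← mul_assoc, mul_inv_cancel₀ hw, one_mul]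
  have hVff : ∀ κ u (x z : Fin (d + 1) → ℤ) (β β' : Fin (d + 1)), ((cVH * wVH d Lc (j + 1)) • V κ u) x z (Sum.inl β) (Sum.inl β') = 0 :=
    fun κ u x z β β' => smul_slot_inl_inl hV0 _ κ u x z β β'
  -- the next-level tables in `mmRead` form
  have eSp : ∀ (κ : Fin (d + 1)) (u : Fin (d + 1) → ℤ), SpureRecOf d Lc V H (GcombSh Lc) cE cVH cΛ (j + 1) κ u =
      (cE * wE d Lc (j + 1)) • mmRead Lc (K2OfK (GcombSh (d := d) Lc j) Lc (SpureRecOf d Lc V H (GcombSh Lc) cE cVH cΛ j) (M1Of d Lc H cΛ j) κ u) +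
        (cVH * wVH d Lc (j + 1)) • V κ u := fun κ u => SpureRecOf_succ_eq_mmRead_comb hV hH cE cVH cΛ j κ u
  simp only [eSp] at hBfm hBmf hBmm ⊢
  rw [T2RecOf_succ_eq_mmRead, T2RecOf_succ_eq_mmRead]
  exact quarticStep_bref_of_laws_gen (cg := ctGenM d (bhK Lc + Dsh Lc) α Lc) (hh := fun κ u κ' u' => mmSym Lc (X2s κ u κ' u')) hw hγ' ha hff hB0 hRBff
    hVff hQ hBfm hBmf hBmm κ u κ' u'

end CombStep

end Summit.QuantumFields.BalabanUV.Beta.SpineRooted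

end
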